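import Literature.NumberTheory.Transcendental.ShidlovskyRegularPoint
import Mathlib.RingTheory.PowerSeries.NoZeroDivisors
import Mathlib.LinearAlgebra.Alternating.Basic
import Mathlib.LinearAlgebra.LinearIndependent.Lemmas
import Mathlib.Tactic
import HarnessLib

/-!
# Shidlovsky's lemma, III: Mahler's lemma (13) and the uniformity at a regular point

Third part of the formalization of Shidlovsky's lemma after K. Mahler, *Lectures on
transcendental numbers*, LNM 546, Ch. 3 [Mahler1976] (input of
[CalegariDimitrovTang2024, §3.2 Theorem 37]). Contents:

* `exists_degree_bound` — **Mahler's lemma (13)** (§56) in abstract form: for a fixed finite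
  family `Φ` of power series and an injective `σ : K[X] →+* K⟦X⟧`, rational functions `E/δ`
  presented as `−Ω¹/Ω⁰` with `Ω⁰ ≠ 0, Ω¹` in the `K`-span of `Φ` can be written `η/ε` with
  `deg ε, deg η` bounded only in terms of `Φ`, and `ε` depending only on `Ω⁰` (maximal
  `K[X]`-independent subfamily + clearing denominators, as printed).
* `det_of_sum_mul_eq` — expansion of a determinant whose columns are combinations of the columns
  of a fixed matrix (multilinearity), used to see the determinants of §56 in the `K`-span of the
  minors of the fundamental matrix.
* `uniformity` — §§54–56 assembled: at a regular point `c`, given the rank relation and a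
  non-singular `μ × μ` minor of `(p_{h,k})_{h ≤ μ}` on columns `I` with complement `J`, the
  `m − μ` killed solutions of lemma (3) give (10), `det Ω ≠ 0` (§55), (12) by Cramer, and
  lemma (13) yields `ε ≠ 0`, `η_{ij}` of degree `≤ d₁ = d₁(κ, B, c)` with
  `ε p_{h, J j} = Σ_i p_{h, I i} η_{ij}` (`h ≤ μ`).

## References
* [Mahler1976] K. Mahler, *Lectures on transcendental numbers*, LNM 546, Springer 1976,
  Ch. 3 §§54–56.
* [CalegariDimitrovTang2024] F. Calegari, V. Dimitrov, Y. Tang, arXiv:2408.15403, §3.2 Thm 37.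
-/

namespace Literature.NumberTheory.Transcendental

namespace Shidlovsky

open Polynomial Finset
open scoped PowerSeries Matrix

noncomputable section

variable {K : Type*} [Field K]
/-! ### Mahler's lemma (13): bounded degrees for rational functions presented over a fixed finite
family of series -/

/-- `K⟦X⟧` as a `K[X]`-module through a ring homomorphism `σ : K[X] →+* K⟦X⟧` (type synonym).
[folklore] -/
def Through (_σ : K[X] →+* K⟦X⟧) : Type _ := K⟦X⟧

/-- The additive group structure of `K⟦X⟧`. [folklore] -/
instance (σ : K[X] →+* K⟦X⟧) : AddCommGroup (Through σ) := inferInstanceAs (AddCommGroup K⟦X⟧)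

/-- `K[X]` acting on `K⟦X⟧` through `σ`. [folklore] -/
instance (σ : K[X] →+* K⟦X⟧) : Module K[X] (Through σ) := Module.compHom K⟦X⟧ σ

/-- The identity `K⟦X⟧ → Through σ`. [folklore] -/
def toThrough (σ : K[X] →+* K⟦X⟧) (x : K⟦X⟧) : Through σ := x

/-- The scalar action through `σ` is multiplication by `σ p`. [folklore] -/
theorem through_smul (σ : K[X] →+* K⟦X⟧) (p : K[X]) (x : K⟦X⟧) :
    (p • toThrough σ x : Through σ) = toThrough σ (σ p * x) := rfl

/-- `toThrough` is additive. [folklore] -/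
theorem toThrough_add (σ : K[X] →+* K⟦X⟧) (x y : K⟦X⟧) :
    toThrough σ (x + y) = toThrough σ x + toThrough σ y := rfl

/-- `toThrough 0 = 0`. [folklore] -/
theorem toThrough_zero (σ : K[X] →+* K⟦X⟧) : toThrough σ 0 = (0 : Through σ) := rfl

/-- `toThrough` is injective (it is the identity). [folklore] -/
theorem toThrough_injective (σ : K[X] →+* K⟦X⟧) : Function.Injective (toThrough σ) := fun _ _ h => h

/-- `toThrough` commutes with finite sums. [folklore] -/
theorem toThrough_sum (σ : K[X] →+* K⟦X⟧) {ι : Type*} (s : Finset ι) (f : ι → K⟦X⟧) :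
    toThrough σ (∑ i ∈ s, f i) = ∑ i ∈ s, toThrough σ (f i) := by
  classical
  induction s using Finset.induction_on with
  | empty => rfl
  | insert a s ha ih => rw [Finset.sum_insert ha, Finset.sum_insert ha, toThrough_add, ih]

/-- **Mahler's lemma (13), abstract form.** Fix an injective `σ : K[X] →+* K⟦X⟧` and a finite
family of series `Φ`. There is a bound `d₁` such that: whenever `Ω⁰ ≠ 0` and `Ω¹` are
`K`-combinations of the `Φ_i` and polynomials `E, δ` satisfy `σ(E) Ω⁰ + σ(δ) Ω¹ = 0` (so that
`E/δ = −Ω¹/Ω⁰` is a rational function), then `E/δ = η/ε` with `deg ε, deg η ≤ d₁`, where moreover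
`ε ≠ 0` depends only on `Ω⁰`. Proof as printed: choose a maximal `K[X]`-independent subfamily of
`Φ` and clear denominators. [cite: Mahler1976, Ch. 3 §56 lemma (13) (pp. 66–67)] -/
theorem exists_degree_bound (σ : K[X] →+* K⟦X⟧) (hσ : Function.Injective σ) {ι : Type*} [Fintype ι]
    (Φ : ι → K⟦X⟧) :
    ∃ d₁ : ℕ, ∀ c₀ : ι → K, ∑ i, σ (C (c₀ i)) * Φ i ≠ 0 →
      ∃ ε : K[X], ε ≠ 0 ∧ ε.natDegree ≤ d₁ ∧
        ∀ (c₁ : ι → K) (E δ : K[X]),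
          σ E * (∑ i, σ (C (c₀ i)) * Φ i) + σ δ * (∑ i, σ (C (c₁ i)) * Φ i) = 0 →
          ∃ η : K[X], η.natDegree ≤ d₁ ∧ ε * E = δ * η := by
  classical
  -- a maximal `K[X]`-independent subfamily through `σ`
  obtain ⟨s, hind, hmax⟩ := exists_maximal_linearIndepOn K[X] (fun i => toThrough σ (Φ i))
  -- denominators `A i` and numerators `G i j` presenting `A i • Φ i` over the subfamily
  have hrep : ∀ i, ∃ A : K[X], A ≠ 0 ∧ ∃ G : s → K[X], σ A * Φ i = ∑ j, σ (G j) * Φ j := by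
    intro i
    by_cases hi : i ∈ s
    · refine ⟨1, one_ne_zero, fun j => if (j : ι) = i then 1 else 0, ?_⟩
      rw [map_one, one_mul]
      rw [Finset.sum_eq_single (⟨i, hi⟩ : s)]
      · simp
      · intro j _ hj
        simp only
        rw [if_neg (fun h => hj (Subtype.ext h)), map_zero, zero_mul]
      · intro h; exact absurd (Finset.mem_univ _) h
    · obtain ⟨a, ha, hmem⟩ := hmax i hi
      have hrange : (fun i => toThrough σ (Φ i)) '' s = Set.range (fun j : s => toThrough σ (Φ j)) := by
        ext x; simp
      rw [hrange] at hmem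
      obtain ⟨g, hg⟩ := (Submodule.mem_span_range_iff_exists_fun K[X]).mp hmem
      refine ⟨a, ha, g, ?_⟩
      apply toThrough_injective σ
      rw [← through_smul, ← hg, toThrough_sum]
      rfl
  choose A hA0 G hG using hrep
  -- independence of the subfamily, in explicit form
  have hindep : ∀ r : s → K[X], ∑ j, σ (r j) * Φ j = 0 → ∀ j, r j = 0 := by
    intro r hr
    have hli : LinearIndependent K[X] (fun j : s => toThrough σ (Φ j)) := hind.linearIndependent
    refine (Fintype.linearIndependent_iff.mp hli) r ?_
    simp_rw [through_smul]
    rw [← toThrough_sum, hr]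
    rfl
  -- the bound
  refine ⟨∑ i, (A i).natDegree + Finset.univ.sup (fun ij : ι × s => (G ij.1 ij.2).natDegree), ?_⟩
  intro c₀ hΩ₀
  -- `Gtot = ∏ A i`, and `Gtot • Φ i = Σ_j (∏_{i'≠i} A i' · G i j) • Φ j`
  set Atot : K[X] := ∏ i, A i with hAtot
  have hAtot0 : Atot ≠ 0 := Finset.prod_ne_zero_iff.mpr fun i _ => hA0 i
  set M : ι → s → K[X] := fun i j => (∏ i' ∈ Finset.univ.erase i, A i') * G i j with hM
  have hMdeg : ∀ i j, (M i j).natDegree ≤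
      ∑ i, (A i).natDegree + Finset.univ.sup (fun ij : ι × s => (G ij.1 ij.2).natDegree) := by
    intro i j
    refine natDegree_mul_le.trans (add_le_add ?_ ?_)
    · refine (natDegree_prod_le _ _).trans ?_
      exact Finset.sum_le_sum_of_subset_of_nonneg (Finset.erase_subset _ _) fun _ _ _ => Nat.zero_le _
    · exact Finset.le_sup (f := fun ij : ι × s => (G ij.1 ij.2).natDegree) (Finset.mem_univ (i, j))
  have hAΦ : ∀ i, σ Atot * Φ i = ∑ j, σ (M i j) * Φ j := by
    intro i
    have hsplit : Atot = (∏ i' ∈ Finset.univ.erase i, A i') * A i := by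
      rw [hAtot, Finset.prod_erase_mul _ _ (Finset.mem_univ i)]
    rw [hsplit, map_mul, mul_assoc, hG i, Finset.mul_sum]
    refine Finset.sum_congr rfl fun j _ => ?_
    rw [hM]; simp only [map_mul]; ring
  -- `β`-coefficients of `Atot • Σ c Φ`
  set β : (ι → K) → s → K[X] := fun c j => ∑ i, C (c i) * M i j with hβ
  have hβdeg : ∀ c j, (β c j).natDegree ≤
      ∑ i, (A i).natDegree + Finset.univ.sup (fun ij : ι × s => (G ij.1 ij.2).natDegree) := by
    intro c j
    refine natDegree_sum_le_of_forall_le _ _ fun i _ => ?_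
    refine natDegree_mul_le.trans ?_
    rw [natDegree_C, zero_add]
    exact hMdeg i j
  have hexp : ∀ c : ι → K, σ Atot * ∑ i, σ (C (c i)) * Φ i = ∑ j, σ (β c j) * Φ j := by
    intro c
    rw [Finset.mul_sum]
    have : ∀ i, σ Atot * (σ (C (c i)) * Φ i) = ∑ j, σ (C (c i)) * σ (M i j) * Φ j := by
      intro i
      rw [mul_left_comm, hAΦ i, Finset.mul_sum]
      exact Finset.sum_congr rfl fun j _ => by ring
    simp_rw [this]
    rw [Finset.sum_comm]
    refine Finset.sum_congr rfl fun j _ => ?_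
    rw [hβ]
    simp only [map_sum, map_mul, Finset.sum_mul]
  -- some `β c₀ j₀ ≠ 0`
  have hβ0 : ∃ j₀, β c₀ j₀ ≠ 0 := by
    by_contra hall
    push Not at hall
    apply hΩ₀
    have h1 : σ Atot * ∑ i, σ (C (c₀ i)) * Φ i = 0 := by
      rw [hexp]; exact Finset.sum_eq_zero fun j _ => by rw [hall j, map_zero, zero_mul]
    rcases mul_eq_zero.mp h1 with h | h
    · exact absurd h (fun h' => hAtot0 (hσ (by rw [h', map_zero])))
    · exact h
  obtain ⟨j₀, hj₀⟩ := hβ0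
  refine ⟨β c₀ j₀, hj₀, hβdeg c₀ j₀, fun c₁ E δ hrel => ⟨-β c₁ j₀, ?_, ?_⟩⟩
  · rw [natDegree_neg]; exact hβdeg c₁ j₀
  · -- multiply the relation by `σ Atot` and read off the `j₀`-coefficient
    have h1 : ∑ j, σ (E * β c₀ j + δ * β c₁ j) * Φ j = 0 := by
      have hA : σ Atot * (σ E * ∑ i, σ (C (c₀ i)) * Φ i + σ δ * ∑ i, σ (C (c₁ i)) * Φ i) =
          σ Atot * 0 := by rw [hrel]
      rw [mul_zero, mul_add, mul_left_comm, hexp c₀, mul_left_comm (σ Atot), hexp c₁, Finset.mul_sum,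
        Finset.mul_sum, ← Finset.sum_add_distrib] at hA
      rw [← hA]
      refine Finset.sum_congr rfl fun j _ => ?_
      simp only [map_add, map_mul]; ring
    have h2 : E * β c₀ j₀ + δ * β c₁ j₀ = 0 := hindep (fun j => E * β c₀ j + δ * β c₁ j) h1 j₀
    linear_combination h2

/-! ### Determinants with columns in the span of a fixed matrix -/
/-- **Expansion of a determinant in columns that are combinations of the columns of a fixed
matrix**: if column `k` of an `n × n` matrix is `Σ_s x_{k s} · (column s of v, rows ρ)`, its
determinant is `Σ_τ (∏_k x_{k τ(k)}) det (v_{ρ(r) τ(k)})`. [folklore] -/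
theorem det_of_sum_mul_eq {R : Type*} [CommRing R] {n m : ℕ} (v : Matrix (Fin m) (Fin m) R)
    (ρ : Fin n → Fin m) (x : Fin n → Fin m → R) :
    Matrix.det (Matrix.of fun (r k : Fin n) => ∑ s, v (ρ r) s * x k s) =
      ∑ τ : Fin n → Fin m, (∏ k, x k (τ k)) * (v.submatrix ρ τ).det := by
  classical
  -- pass to the transpose, whose rows are the combinations
  set N : Matrix (Fin n) (Fin n) R := Matrix.of fun (r k : Fin n) => ∑ s, v (ρ r) s * x k s with hN
  set col : Fin m → (Fin n → R) := fun s r => v (ρ r) s with hcol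
  have hT : Nᵀ = fun k => ∑ s, x k s • col s := by
    ext k r
    simp only [hN, hcol, Matrix.transpose_apply, Matrix.of_apply, Finset.sum_apply, Pi.smul_apply,
      smul_eq_mul]
    exact Finset.sum_congr rfl fun s _ => mul_comm _ _
  rw [← Matrix.det_transpose, hT]
  -- multilinearity of `det` in the rows
  have hdet : ∀ M : Fin n → (Fin n → R), Matrix.det (Matrix.of M) =
      (Matrix.detRowAlternating : (Fin n → R) [⋀^Fin n]→ₗ[R] R).toMultilinearMap M := fun M => rfl
  have key := (Matrix.detRowAlternating : (Fin n → R) [⋀^Fin n]→ₗ[R] R).toMultilinearMap.map_sum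
    (fun k s => x k s • col s)
  have h1 : Matrix.det (fun k => ∑ s, x k s • col s) =
      (Matrix.detRowAlternating : (Fin n → R) [⋀^Fin n]→ₗ[R] R).toMultilinearMap
        (fun k => ∑ s, x k s • col s) := rfl
  rw [h1, key]
  refine Finset.sum_congr rfl fun τ _ => ?_
  rw [MultilinearMap.map_smul_univ, smul_eq_mul]
  congr 1
  -- identify the term with `det (v.submatrix ρ τ)` via the transpose
  have h2 : (Matrix.detRowAlternating : (Fin n → R) [⋀^Fin n]→ₗ[R] R).toMultilinearMap
      (fun k => col (τ k)) = Matrix.det (Matrix.of fun k => col (τ k)) := rfl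
  rw [h2, ← Matrix.det_transpose]
  congr 1

/-! ### The data at the regular point (Mahler §§54–56) and the uniformity theorem -/

section Uniformity

variable [CharZero K] {m : ℕ} {c : K} {κ : K[X]} {B : Matrix (Fin m) (Fin m) K[X]}

omit [CharZero K] in
/-- `sh c` sends constants to constants. [folklore] -/
theorem sh_C (c : K) (r : K) : sh c (Polynomial.C r) = PowerSeries.C r := by
  rw [sh_apply, Polynomial.C_comp, Polynomial.coe_C]

/-- Index type of the fixed family of minors of the fundamental matrix. [folklore] -/
abbrev MinorIdx (m : ℕ) : Type := (n : Fin (m + 1)) × ((Fin n → Fin m) × (Fin n → Fin m))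

/-- The fixed family of minors `det (v_{ρ(r) τ(k)})` (all sizes `n ≤ m`, all row and column
selections, repetitions allowed) of the fundamental matrix `v` at the regular point.
[cite: Mahler1976, Ch. 3 §56 (the minors `φ_1,…,φ_s` of `v`)] -/
def minorFamily (c : K) (κ : K[X]) (B : Matrix (Fin m) (Fin m) K[X]) (hc : κ.eval c ≠ 0) :
    MinorIdx m → K⟦X⟧ :=
  fun idx => ((FormalODE.fundMatrix (regMatrix c κ B hc)).submatrix idx.2.1 idx.2.2).det

omit [CharZero K] in
/-- A combination indexed through a map into the family is a combination over the family.
[folklore] -/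
theorem exists_comb_of_map {T ι : Type*} [Fintype T] [Fintype ι] [DecidableEq ι]
    (Φ : ι → K⟦X⟧) (g : T → ι) (cτ : T → K) (σ : K[X] →+* K⟦X⟧) :
    ∃ c₀ : ι → K, ∑ idx, σ (Polynomial.C (c₀ idx)) * Φ idx = ∑ τ, σ (Polynomial.C (cτ τ)) * Φ (g τ) := by
  refine ⟨fun idx => ∑ τ, if g τ = idx then cτ τ else 0, ?_⟩
  have : ∀ idx, σ (Polynomial.C (∑ τ, if g τ = idx then cτ τ else 0)) * Φ idx =
      ∑ τ, if g τ = idx then σ (Polynomial.C (cτ τ)) * Φ idx else 0 := by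
    intro idx
    rw [map_sum, map_sum, Finset.sum_mul]
    refine Finset.sum_congr rfl fun τ _ => ?_
    split_ifs <;> simp
  simp_rw [this]
  rw [Finset.sum_comm]
  refine Finset.sum_congr rfl fun τ _ => ?_
  rw [Finset.sum_ite_eq, if_pos (Finset.mem_univ _)]

/-- **The uniformity theorem** (Mahler's lemma (13) with §§54–56): at a regular point `c` of the
system there is a bound `d₁`, depending only on the system and `c`, such that for every linear
form whose derived forms have rank `μ` witnessed by a relation `d λ_{μ+1} = Σ_{i ≤ μ} a_i λ_i` and a
non-singular `μ × μ` minor on the columns `I` (complementary columns `J`), the rational functions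
`e_{ij}` with `λ_{h,J j} = Σ_i λ_{h, I i} e_{ij}` admit a common denominator `ε` and numerators
`η_{ij}` of degree `≤ d₁`: `ε λ_{h, J j} = Σ_i λ_{h, I i} η_{ij}` for all `h ≤ μ`.
[cite: Mahler1976, Ch. 3 §§54–56, lemma (13) (pp. 64–67)] -/
theorem uniformity (hc : κ.eval c ≠ 0) :
    ∃ d₁ : ℕ, ∀ (P : ℕ → Fin m → K[X]), (∀ h, P (h + 1) = derivOp κ B (P h)) →
      ∀ (μ : ℕ) (hμ : μ ≤ m) (d : K[X]), d ≠ 0 → ∀ (a : Fin μ → K[X]), d • P μ = ∑ i, a i • P i →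
      ∀ (I : Fin μ → Fin m) (J : Fin (m - μ) → Fin m), Function.Bijective (Sum.elim I J) →
      (Matrix.of fun (h i : Fin μ) => P h (I i)).det ≠ 0 →
      ∃ ε : K[X], ε ≠ 0 ∧ ε.natDegree ≤ d₁ ∧ ∃ η : Fin μ → Fin (m - μ) → K[X],
        (∀ i j, (η i j).natDegree ≤ d₁) ∧
        ∀ (h : Fin μ) (j : Fin (m - μ)), ε * P h (J j) = ∑ i, P h (I i) * η i j := by
  classical
  have hκ : κ ≠ 0 := by rintro rfl; exact hc (by simp)
  obtain ⟨d₁, hd₁⟩ := exists_degree_bound (sh c) (sh_injective c) (minorFamily c κ B hc)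
  refine ⟨d₁, fun P hP μ hμ d hd a hrel I J hIJ hδ => ?_⟩
  set q := regMatrix c κ B hc with hq
  set vF := FormalODE.fundMatrix q with hvF
  -- the killed solutions
  obtain ⟨w, hwsol, hwkill, hwli⟩ := exists_killed_solutions hc hκ hP hd hrel
  -- the matrices `R_I`, `R_J`, `E = adj(R_I) R_J`, `δ = det R_I`
  set RI : Matrix (Fin μ) (Fin μ) K[X] := Matrix.of fun h i => P h (I i) with hRI
  set RJ : Matrix (Fin μ) (Fin (m - μ)) K[X] := Matrix.of fun h j => P h (J j) with hRJ
  set δ : K[X] := RI.det with hδdef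
  set E : Matrix (Fin μ) (Fin (m - μ)) K[X] := RI.adjugate * RJ with hE
  have hRIE : RI * E = δ • RJ := by
    rw [hE, ← Matrix.mul_assoc, Matrix.mul_adjugate, Matrix.smul_mul, Matrix.one_mul]
  -- the bijection `Fin μ ⊕ Fin (m - μ) ≃ Fin m`
  set e : Fin μ ⊕ Fin (m - μ) ≃ Fin m := Equiv.ofBijective (Sum.elim I J) hIJ with he
  have hsplit : ∀ f : Fin m → K⟦X⟧, ∑ l, f l = ∑ i, f (I i) + ∑ j, f (J j) := by
    intro f
    rw [← Equiv.sum_comp e, Fintype.sum_sum_type]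
    rfl
  -- (10'): `sh δ · w_k(I i) + Σ_j sh(E i j) · w_k(J j) = 0`
  have h10 : ∀ i k, sh c δ * w k (I i) + ∑ j, sh c (E i j) * w k (J j) = 0 := by
    intro i k
    -- the relations `λ_h(w_k) = 0`
    have hstar : ∀ h : Fin μ, ∑ i', sh c (RI h i') * w k (I i') + ∑ j, sh c (RJ h j) * w k (J j) = 0 := by
      intro h
      have := hwkill k h h.isLt
      unfold evalForm at this
      rw [hsplit] at this
      simpa [hRI, hRJ] using this
    have hsum : ∑ h, sh c (RI.adjugate i h) *
        (∑ i', sh c (RI h i') * w k (I i') + ∑ j, sh c (RJ h j) * w k (J j)) = 0 :=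
      Finset.sum_eq_zero fun h _ => by rw [hstar h, mul_zero]
    rw [← hsum]
    simp_rw [mul_add, Finset.sum_add_distrib, Finset.mul_sum]
    congr 1
    · -- `Σ_h adj_ih RI_hi' = δ δ_{ii'}`
      rw [Finset.sum_comm]
      have hadj : ∀ i', ∑ h, sh c (RI.adjugate i h) * (sh c (RI h i') * w k (I i')) =
          sh c ((RI.adjugate * RI) i i') * w k (I i') := by
        intro i'
        rw [Matrix.mul_apply, map_sum, Finset.sum_mul]
        exact Finset.sum_congr rfl fun h _ => by rw [map_mul]; ring
      simp_rw [hadj, Matrix.adjugate_mul]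
      rw [Finset.sum_eq_single i]
      · simp [hδdef]
      · intro i' _ hi'
        rw [Matrix.smul_apply, Matrix.one_apply_ne (Ne.symm hi'), smul_zero, map_zero, zero_mul]
      · intro h; exact absurd (Finset.mem_univ i) h
    · rw [Finset.sum_comm]
      refine Finset.sum_congr rfl fun j _ => ?_
      rw [hE, Matrix.mul_apply, map_sum, Finset.sum_mul]
      exact Finset.sum_congr rfl fun h _ => by rw [map_mul]; ring
  -- `Ω` and `det Ω ≠ 0` (§55)
  set Ω : Matrix (Fin (m - μ)) (Fin (m - μ)) K⟦X⟧ := Matrix.of fun j k => w k (J j) with hΩ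
  have hΩdet : Ω.det ≠ 0 := by
    intro hdet0
    obtain ⟨cv, hcv0, hcv⟩ := Matrix.exists_mulVec_eq_zero_iff.mpr hdet0
    have hJ : ∀ j, ∑ k, cv k * w k (J j) = 0 := by
      intro j
      have := congrFun hcv j
      simp only [Matrix.mulVec, dotProduct, hΩ, Matrix.of_apply, Pi.zero_apply] at this
      rw [← this]
      exact Finset.sum_congr rfl fun k _ => mul_comm _ _
    have hI : ∀ i, ∑ k, cv k * w k (I i) = 0 := by
      intro i
      have h1 : sh c δ * ∑ k, cv k * w k (I i) = -∑ j, sh c (E i j) * ∑ k, cv k * w k (J j) := by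
        rw [Finset.mul_sum, eq_neg_iff_add_eq_zero]
        have : ∑ j, sh c (E i j) * ∑ k, cv k * w k (J j) = ∑ k, cv k * ∑ j, sh c (E i j) * w k (J j) := by
          simp_rw [Finset.mul_sum]
          rw [Finset.sum_comm]
          exact Finset.sum_congr rfl fun k _ => Finset.sum_congr rfl fun j _ => by ring
        rw [this, ← Finset.sum_add_distrib]
        refine Finset.sum_eq_zero fun k _ => ?_
        have := h10 i k
        linear_combination (cv k) * this
      have h2 : sh c δ * ∑ k, cv k * w k (I i) = 0 := by
        rw [h1, neg_eq_zero]
        exact Finset.sum_eq_zero fun j _ => by rw [hJ j, mul_zero]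
      exact (mul_eq_zero.mp h2).resolve_left (sh_ne_zero c hδ)
    have hrel0 : ∑ k, cv k • w k = 0 := by
      funext l
      rw [Finset.sum_apply, Pi.zero_apply]
      simp only [Pi.smul_apply, smul_eq_mul]
      obtain ⟨x, rfl⟩ := e.surjective l
      rcases x with i | j
      · exact hI i
      · exact hJ j
    obtain ⟨k, hk⟩ := Function.ne_iff.mp hcv0
    exact hk (Fintype.linearIndependent_iff.mp hwli cv hrel0 k)
  -- (12'): `sh(E i j) det Ω = − sh δ · det(Ω with row j replaced by (w_k(I i))_k)`
  have h12 : ∀ i j, sh c (E i j) * Ω.det + sh c δ * (Ω.updateRow j (fun k => w k (I i))).det = 0 := by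
    intro i j
    set Wi : Fin (m - μ) → K⟦X⟧ := fun k => w k (I i) with hWi
    set shE : Fin (m - μ) → K⟦X⟧ := fun j' => sh c (E i j') with hshE
    -- `sh δ • Wi = −(shE ᵥ* Ω)`
    have hvec : sh c δ • Wi = -(shE ᵥ* Ω) := by
      funext k
      rw [Pi.smul_apply, smul_eq_mul, Pi.neg_apply, Matrix.vecMul, dotProduct, eq_neg_iff_add_eq_zero]
      simpa [hWi, hshE, hΩ] using h10 i k
    have hvec2 : sh c δ • (Wi ᵥ* Ω.adjugate) = -(Ω.det • shE) := by
      rw [← Matrix.smul_vecMul, hvec, Matrix.neg_vecMul, Matrix.vecMul_vecMul, Matrix.mul_adjugate,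
        Matrix.vecMul_smul, Matrix.vecMul_one]
    have hj := congrFun hvec2 j
    simp only [Pi.smul_apply, smul_eq_mul, Pi.neg_apply] at hj
    -- `(Wi ᵥ* adj Ω) j = det (Ω.updateRow j Wi)`
    have hcr : (Wi ᵥ* Ω.adjugate) j = (Ω.updateRow j Wi).det := by
      rw [← Matrix.mulVec_transpose, Matrix.adjugate_transpose, ← Matrix.cramer_eq_adjugate_mulVec,
        Matrix.cramer_transpose_apply]
    rw [hcr] at hj
    rw [hshE] at hj
    simp only at hj
    linear_combination hj
  -- constant parts `α` and the expansions of the determinants over the family of minors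
  set α : Fin (m - μ) → Fin m → K := fun k s => PowerSeries.constantCoeff (w k s) with hα
  have hw_eq : ∀ k l, w k l = ∑ s, vF l s * PowerSeries.C (α k s) := by
    intro k l
    have := FormalODE.eq_fundMatrix_mulVec q (hwsol k)
    have hl := congrFun this l
    rw [hl, Matrix.mulVec, dotProduct]
  have hnlt : m - μ < m + 1 := by omega
  -- `det` of a matrix of the shape `(Σ_s vF (ρ r) s C(α k s))` as a combination of minors
  have hexpand : ∀ ρ : Fin (m - μ) → Fin m, ∃ c₀ : MinorIdx m → K,
      ∑ idx, sh c (Polynomial.C (c₀ idx)) * minorFamily c κ B hc idx =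
        (Matrix.of fun (r k : Fin (m - μ)) => ∑ s, vF (ρ r) s * PowerSeries.C (α k s)).det := by
    intro ρ
    let g : (Fin (m - μ) → Fin m) → MinorIdx m := fun τ => ⟨⟨m - μ, hnlt⟩, (ρ, τ)⟩
    obtain ⟨c₀, hc₀⟩ := exists_comb_of_map (minorFamily c κ B hc) g
      (fun τ => ∏ k, α k (τ k)) (sh c)
    refine ⟨c₀, ?_⟩
    rw [hc₀, det_of_sum_mul_eq]
    refine Finset.sum_congr rfl fun τ _ => ?_
    rw [sh_C, map_prod]
    rfl
  -- `Ω` itself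
  have hΩshape : Ω = Matrix.of fun (r k : Fin (m - μ)) => ∑ s, vF (J r) s * PowerSeries.C (α k s) := by
    apply Matrix.ext
    intro r k
    simp only [hΩ, Matrix.of_apply]
    exact hw_eq k (J r)
  obtain ⟨c₀, hc₀⟩ := hexpand J
  rw [← hΩshape] at hc₀
  have hΩ0' : ∑ idx, sh c (Polynomial.C (c₀ idx)) * minorFamily c κ B hc idx ≠ 0 := by
    rw [hc₀]; exact hΩdet
  obtain ⟨ε, hε0, hεdeg, hεrel⟩ := hd₁ c₀ hΩ0'
  -- the numerators
  have hη : ∀ i j, ∃ η : K[X], η.natDegree ≤ d₁ ∧ ε * E i j = δ * η := by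
    intro i j
    have hshape : Ω.updateRow j (fun k => w k (I i)) =
        Matrix.of fun (r k : Fin (m - μ)) => ∑ s, vF (Function.update J j (I i) r) s * PowerSeries.C (α k s) := by
      apply Matrix.ext
      intro r k
      rw [Matrix.updateRow_apply, Matrix.of_apply, Function.update_apply]
      split_ifs with h
      · exact hw_eq k (I i)
      · simp only [hΩ, Matrix.of_apply]; exact hw_eq k (J r)
    obtain ⟨c₁, hc₁⟩ := hexpand (Function.update J j (I i))
    rw [← hshape] at hc₁
    refine hεrel c₁ (E i j) δ ?_
    rw [hc₀, hc₁]
    exact h12 i j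
  choose η hηdeg hηrel using hη
  refine ⟨ε, hε0, hεdeg, η, hηdeg, fun h j => ?_⟩
  -- `ε R_J = R_I η` from `R_I E = δ R_J` and `ε E = δ η`
  have h1 : δ * (ε * RJ h j) = δ * ∑ i, RI h i * η i j := by
    have hhj := congrFun (congrFun hRIE h) j
    rw [Matrix.mul_apply, Matrix.smul_apply, smul_eq_mul] at hhj
    calc δ * (ε * RJ h j) = ε * (δ * RJ h j) := by ring
      _ = ε * ∑ i, RI h i * E i j := by rw [hhj]
      _ = ∑ i, RI h i * (ε * E i j) := by rw [Finset.mul_sum]; exact Finset.sum_congr rfl fun i _ => by ring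
      _ = ∑ i, RI h i * (δ * η i j) := by simp_rw [hηrel]
      _ = δ * ∑ i, RI h i * η i j := by rw [Finset.mul_sum]; exact Finset.sum_congr rfl fun i _ => by ring
  have h2 := mul_left_cancel₀ hδ h1
  simpa [hRI, hRJ] using h2

end Uniformity

end

end Shidlovsky

end Literature.NumberTheory.Transcendental
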